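import Literature.NumberTheory.EllipticCurves.RingClassFieldGenusProofs
import Literature.NumberTheory.EllipticCurves.Voight2007.GenusFieldCriterionResidues
import Mathlib.FieldTheory.KummerPolynomial
import HarnessLib

/-!
# Voight 2007, Prop. 3.8, direction ⟸: `√m ∈ K[f]` from the odd-prime and dyadic conditions
# (genus theory of the ring class field; Cox, *Primes of the form x² + ny²*, §9.A with Thm. 6.1)

Topic `NumberTheory/EllipticCurves/Voight2007`. THEOREMS only; the containment half of the discharge
of the named fact `prop38_sqrt_mem_ringClassField_iff` (`RingClassGenusField.lean`; assembled in
`RingClassGenusFieldProofs.lean`). `exists_sq_eq_intCast_ringClassField_of_table`: for `K` imaginary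
quadratic with `d_K = 2^{k_d} w_d` and a fundamental discriminant `m = 2^{k_m} w_m` (normal forms of
`GenusFieldCriterionArithmetic.lean`), if every odd prime factor of `m` divides `d_K` or `f` and the
dyadic table of Cor. 3.9 holds, then `K[f]` contains a square root of `m`. PROOF (generalising the
tree's `sqrt_intCast_mem_ringClassField`): `K[f]` is the class field of `P_{K,ℤ}(f)` (Cox Thm. 11.1);
a degree-one prime `𝔭 ∤ 2 m f d_K` split in it is `(α)`, `α = x + yω ≡ a (mod f)`, so
`N𝔭 = ℓ = x² + txy − m₀y²` with `f ∣ y`, `f ∣ x − a`; the odd primes `q ∣ m` see `ℓ ≡ a²` (`q ∣ f`)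
or `4ℓ ≡ (2x+ty)²` (`q ∣ d_K`), and the dyadic table pins `ℓ mod 8`; hence `(m/ℓ) = 1`
(`jacobiSym_eq_one_of_norm_form`, file `GenusFieldCriterionResidues.lean`), `𝔭` splits in `K(√m)` (`QuadraticExtension.mem_splitPrimes_of_isSquare_zmod`),
and Bauer (`le_of_splitPrimes_subset_of_prime_absNorm_algClosure`) gives `K(√m) ⊆ K[f]`.
HONEST FRAMING: classical class field theory, proved on the tree's proved CFT of `K[f]`.
Mathlib / tree search: as listed; Mathlib `ZMod.isSquare_of_jacobiSym_eq_one`, `ZMod.χ₈_nat_eq_if_mod_eight`,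
`X_pow_sub_C_irreducible_of_prime`; `lean search 'sqrt.*ringClassField|genus class field'`: only the
tree files named above.

## References

* J. Voight, *Quadratic forms that represent almost the same primes*, Math. Comp. 76 (2007), §3
  Prop. 3.8, Cor. 3.9. [Voight2007]
* D. A. Cox, *Primes of the form x² + ny²*, 2nd ed. (2013): §6.A Thm. 6.1, §9.A Thm. 9.2,
  §11.A Thm. 11.1. [Cox2013]
-/

noncomputable section

open NumberField IsDedekindDomain IsDedekindDomain.HeightOneSpectrum Filter Polynomial ZMod
open scoped nonZeroDivisors IntermediateField

namespace Literature.NumberTheory.EllipticCurves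

namespace Voight2007

open Literature.NumberTheory.GaloisRepresentations Literature.NumberTheory.NumberFields
open Literature.NumberTheory.NumberFields.RingClassField
open Literature.NumberTheory.QuadraticFields.RingClass Literature.NumberTheory.QuadraticFields.Quadratic

/-- `K(√d) ⊆ K̄` as a quadratic Galois subextension, for `d` not a square in `K` (copy of the
private helper of `RingClassFieldGenusProofs`). [folklore] -/
private theorem exists_quadratic_intermediateField_of_not_isSquare {K : Type} [Field K]
    [CharZero K] {d : K} (hd : ¬ IsSquare d) :
    ∃ (Q : IntermediateField K (AlgebraicClosure K)) (s : Q), FiniteDimensional K Q ∧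
      Algebra.IsQuadraticExtension K Q ∧ IsGalois K Q ∧
      s ^ 2 = algebraMap K Q d ∧ ∀ r : K, algebraMap K Q r ≠ s := by
  obtain ⟨s₀, hs₀⟩ := IsAlgClosed.exists_pow_nat_eq (algebraMap K (AlgebraicClosure K) d) two_pos
  have hirr : Irreducible (X ^ 2 - C d : K[X]) := by
    refine X_pow_sub_C_irreducible_of_prime Nat.prime_two fun b hb => hd ⟨b, ?_⟩
    rw [← hb]; ring
  have hint : IsIntegral K s₀ := Algebra.IsIntegral.isIntegral s₀
  have hmin : minpoly K s₀ = X ^ 2 - C d := by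
    refine (minpoly.eq_of_irreducible_of_monic hirr ?_ (monic_X_pow_sub_C d two_ne_zero)).symm
    simp [hs₀]
  set Q : IntermediateField K (AlgebraicClosure K) := K⟮s₀⟯ with hQ
  have h2 : Module.finrank K Q = 2 := by
    rw [hQ, IntermediateField.adjoin.finrank hint, hmin, natDegree_X_pow_sub_C]
  haveI hfd : FiniteDimensional K Q := Module.finite_of_finrank_eq_succ h2
  haveI hquad : Algebra.IsQuadraticExtension K Q := { finrank_eq_two' := h2 }
  haveI : IsGalois K Q := inferInstance
  refine ⟨Q, ⟨s₀, IntermediateField.mem_adjoin_simple_self K s₀⟩, hfd, hquad, inferInstance, ?_, ?_⟩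
  · apply Subtype.ext
    rw [SubmonoidClass.mk_pow, IntermediateField.coe_algebraMap_apply]
    exact hs₀
  · intro r hr
    apply hd
    refine ⟨r, ?_⟩
    have h0 : algebraMap K (AlgebraicClosure K) r = s₀ := by
      have := congrArg (fun x : Q => (x : AlgebraicClosure K)) hr
      rwa [IntermediateField.coe_algebraMap_apply] at this
    have h2' : algebraMap K (AlgebraicClosure K) (r ^ 2) = algebraMap K (AlgebraicClosure K) d := by
      rw [map_pow, h0]; exact hs₀
    have := (algebraMap K (AlgebraicClosure K)).injective h2'
    rw [← this]; ring

variable {K : Type} [Field K] [NumberField K]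

/-- **Voight 2007 Prop. 3.8, direction ⟸ (genus theory of the ring class field): `√m ∈ K[f]`.**
Let `K` be imaginary quadratic with `d_K = 2^{k_d} w_d` and `m = 2^{k_m} w_m` a fundamental
discriminant in normal form. If every odd prime factor of `m` divides `d_K` or `f`, and the dyadic
condition of Cor. 3.9 holds, then the ring class field `K[f]` contains a square root of `m`. PROOF
(Cox §9.A with Thm. 6.1): a degree-one prime `𝔭 = (α) ∤ 2 m f d_K` of `K` with `α ≡ a (mod f)`
(i.e. split in `K[f]`) has `N𝔭 = ℓ = x² + txy − m₀y²` with `f ∣ y`, `f ∣ x − a`, whence `(m/ℓ) = 1`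
by the assigned characters of `f² d_K` (Jacobi reciprocity); so `𝔭` splits in `K(√m)` and Bauer's
theorem gives `K(√m) ⊆ K[f]`. [cite: Voight2007, §3 Prop. 3.8 and Cor. 3.9]
[cite: Cox2013, §9.A Thm. 9.2 and §6.A Thm. 6.1] -/
theorem exists_sq_eq_intCast_ringClassField_of_table (hK : IsImaginaryQuadratic K) (ι : K →+* ℂ)
    {f : ℕ} (hf : f ≠ 0) {m : ℤ} {km : ℕ} {wm : ℤ} (hmd : m = 2 ^ km * wm) (hwm : Odd wm)
    (hkm : (km = 0 ∧ wm % 4 = 1) ∨ (km = 2 ∧ wm % 4 = 3) ∨ km = 3)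
    {kd : ℕ} {wd : ℤ} (hdd : NumberField.discr K = 2 ^ kd * wd) (hwd : Odd wd)
    (hkd : (kd = 0 ∧ wd % 4 = 1) ∨ (kd = 2 ∧ wd % 4 = 3) ∨ kd = 3)
    (hodd : ∀ q : ℕ, q.Prime → q ≠ 2 → (q : ℤ) ∣ m → (q : ℤ) ∣ NumberField.discr K ∨ q ∣ f)
    (hT : km = 0 ∨ (km = 2 ∧ ((kd = 0 ∧ 4 ∣ f) ∨ kd = 2 ∨ (kd = 3 ∧ 2 ∣ f))) ∨
      (km = 3 ∧ ((kd = 0 ∧ 8 ∣ f) ∨ (kd = 2 ∧ 4 ∣ f) ∨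
        (kd = 3 ∧ (wm % 4 = wd % 4 ∨ 2 ∣ f))))) :
    ∃ r : ringClassField K ι f, r ^ 2 = (m : ringClassField K ι f) := by
  classical
  -- it suffices to find ONE square root of `m` in `K[f] ⊂ ℂ`
  suffices hz : ∃ z : ℂ, z ∈ ringClassField K ι f ∧ z ^ 2 = (m : ℂ) by
    obtain ⟨z, hz, hz2⟩ := hz
    refine ⟨⟨z, hz⟩, Subtype.ext ?_⟩
    simpa using hz2
  by_cases hsqK : IsSquare (m : K)
  · obtain ⟨k, hk⟩ := hsqK
    refine ⟨ι k, apply_mem_ringClassField ι f k, ?_⟩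
    rw [sq, ← map_mul, ← hk, map_intCast]
  -- basic facts about `m`, `d`
  have hwm0 : wm ≠ 0 := by rintro rfl; exact absurd hwm (by decide)
  have hm0 : m ≠ 0 := by rw [hmd]; exact mul_ne_zero (pow_ne_zero _ two_ne_zero) hwm0
  set d : ℤ := NumberField.discr K with hddef
  have hd0 : d ≠ 0 := NumberField.discr_ne_zero K
  -- the quadratic field `Q = K(√m) ⊆ K̄` and the class field `R ≅ K[f]`
  obtain ⟨Q, s, hfdQ, hquad, hgalQ, hs2, hsK⟩ :=
    exists_quadratic_intermediateField_of_not_isSquare (K := K) hsqK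
  haveI := hfdQ
  haveI := hquad
  haveI := hgalQ
  haveI : NumberField Q := NumberField.of_module_finite K Q
  obtain ⟨R, hfd, hgal, -, hsplit, ⟨e⟩⟩ := exists_classField_algEquiv_ringClassField hK ι hf
  haveI := hfd
  haveI := hgal
  -- an integral basis `(1, ω)`, `ω² = m₀ + t ω`, `d = t² + 4 m₀`
  obtain ⟨b, hb⟩ := exists_basis_zero_eq_one (K := K) hK.finrank_eq_two
  set m₀ : ℤ := b.repr (b 1 * b 1) 0 with hm₀
  set t : ℤ := b.repr (b 1 * b 1) 1 with ht
  have hω : b 1 * b 1 = (m₀ : 𝓞 K) + (t : 𝓞 K) * b 1 := basis_one_mul_self_eq b hb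
  have hdisc : d = t ^ 2 + 4 * m₀ := discr_eq_sq_add_four_mul b hb
  -- Bauer: `Q ≤ R`, testing on degree-one primes `v ∤ 2 f m d` that split completely in `R`
  have hQR : Q ≤ R := by
    refine le_of_splitPrimes_subset_of_prime_absNorm_algClosure ?_
    set M : ℕ := 2 * f * m.natAbs * d.natAbs with hMdef
    have hM0 : M ≠ 0 := by
      rw [hMdef]
      exact mul_ne_zero (mul_ne_zero (mul_ne_zero two_ne_zero hf) (Int.natAbs_ne_zero.mpr hm0))
        (Int.natAbs_ne_zero.mpr hd0)
    have h𝔪 : Ideal.span {((M : ℕ) : 𝓞 K)} ≠ ⊥ := by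
      rw [Ne, Ideal.span_singleton_eq_bot]; exact_mod_cast hM0
    have hev : ∀ᶠ v : HeightOneSpectrum (𝓞 K) in cofinite,
        ¬ Ideal.span {((M : ℕ) : 𝓞 K)} ≤ v.asIdeal := by
      rw [Filter.eventually_cofinite]
      simpa using finite_setOf_le_asIdeal h𝔪
    refine hev.mono fun v hv hprime hvR => ?_
    set ℓ : ℕ := Ideal.absNorm v.asIdeal with hℓdef
    have hℓv : ((ℓ : ℕ) : 𝓞 K) ∈ v.asIdeal := Ideal.absNorm_mem v.asIdeal
    have hmem_of_dvd : ∀ n : ℕ, n ∣ M → ((n : ℕ) : 𝓞 K) ∈ v.asIdeal →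
        Ideal.span {((M : ℕ) : 𝓞 K)} ≤ v.asIdeal := fun n hn hnv => by
      rw [Ideal.span_singleton_le_iff_mem]
      obtain ⟨k, hk⟩ := hn
      rw [hk, Nat.cast_mul]
      exact Ideal.mul_mem_right _ _ hnv
    have hfM : f ∣ M := ⟨2 * m.natAbs * d.natAbs, by rw [hMdef]; ring⟩
    have hvf : ¬ Ideal.span {((f : ℕ) : 𝓞 K)} ≤ v.asIdeal := fun hle =>
      hv (hmem_of_dvd f hfM ((Ideal.span_singleton_le_iff_mem _).mp hle))
    have hℓM : ¬ ℓ ∣ M := fun h => hv (hmem_of_dvd ℓ h hℓv)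
    have hℓ2 : ℓ ≠ 2 := fun h => hℓM (by rw [h, hMdef]; exact ⟨f * m.natAbs * d.natAbs, by ring⟩)
    have hℓm : ¬ (ℓ : ℤ) ∣ m := fun h => hℓM (by
      rw [hMdef]; exact (Int.natCast_dvd.mp h).mul_left _ |>.mul_right _)
    -- `[𝔭_v] = 1`: `v = (α)`, `α ≡ a (mod f)`
    have h1 : primeClass f v = 1 := (hsplit v hvf).mp hvR
    obtain ⟨α, a, -, hva, hαa⟩ := exists_generator_of_primeClass_eq_one f hvf h1
    -- coordinates `α = x + y ω`, `f ∣ x − a`, `f ∣ y`, `ℓ = N(α) = x² + t x y − m₀ y²`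
    set x : ℤ := b.repr α 0 with hx
    set y : ℤ := b.repr α 1 with hy
    have hαxy : α = (x : 𝓞 K) + (y : 𝓞 K) * b 1 := eq_repr_add_repr_mul_of_basis b hb α
    have hsub : α - (a : 𝓞 K) = ((x - a : ℤ) : 𝓞 K) + (y : 𝓞 K) * b 1 := by
      rw [hαxy]; push_cast; ring
    have hfx : (f : ℤ) ∣ x - a := by
      have := dvd_repr_of_mem_span (f := f) b hαa 0
      rwa [hsub, repr_intCast_add_intCast_mul_zero b hb] at this
    have hfy : (f : ℤ) ∣ y := by
      have := dvd_repr_of_mem_span (f := f) b hαa 1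
      rwa [hsub, repr_intCast_add_intCast_mul_one b hb] at this
    have hnorm : Algebra.norm ℤ α = x ^ 2 + t * x * y - m₀ * y ^ 2 := by
      rw [hαxy]; exact norm_intCast_add_intCast_mul b hb hω x y
    have hN : (ℓ : ℤ) = x ^ 2 + t * x * y - m₀ * y ^ 2 := by
      have hnn : 0 ≤ Algebra.norm ℤ α := by
        rw [hnorm]
        nlinarith [sq_nonneg (2 * x + t * y), sq_nonneg y, hdisc, hK.discr_neg]
      rw [hℓdef, hva, Ideal.absNorm_span_singleton, Int.natCast_natAbs, abs_of_nonneg hnn, hnorm]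
    -- `(ℓ / |w_m|) = 1`: `ℓ` is a non-zero square modulo every (odd) prime `q ∣ m`
    have hodd' : ∀ q : ℕ, q.Prime → q ≠ 2 → (q : ℤ) ∣ m → (q : ℤ) ∣ 2 ^ kd * wd ∨ q ∣ f :=
      fun q hq hq2 hqm => hdd ▸ hodd q hq hq2 hqm
    have hJ : jacobiSym m ℓ = 1 :=
      jacobiSym_eq_one_of_norm_form (hdd.symm.trans hdisc) hwd hkd hmd hwm hkm hodd' hT hprime hℓ2
        hℓm hfx hfy hN
    haveI : Fact ℓ.Prime := ⟨hprime⟩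
    have hsq : IsSquare ((m : ZMod ℓ)) := ZMod.isSquare_of_jacobiSym_eq_one hJ
    exact NumberFields.QuadraticExtension.mem_splitPrimes_of_isSquare_zmod hs2 hsK v hprime hℓ2
      rfl hℓm hsq
  -- transport `s ∈ Q ≤ R ≅ K[f] ⊂ ℂ`
  set sR : R := ⟨(s : AlgebraicClosure K), hQR s.2⟩ with hsR
  have hsR2 : sR ^ 2 = algebraMap K R m := by
    apply Subtype.ext
    have h := congrArg (fun x : Q => (x : AlgebraicClosure K)) hs2
    rw [SubmonoidClass.coe_pow, IntermediateField.coe_algebraMap_apply] at h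
    rw [SubmonoidClass.coe_pow, IntermediateField.coe_algebraMap_apply]
    exact h
  refine ⟨((e sR : ringClassField K ι f) : ℂ), (e sR).2, ?_⟩
  have h3 : (e sR) ^ 2 = algebraMap K (ringClassField K ι f) m := by
    rw [← map_pow, hsR2, AlgEquiv.commutes]
  have h4 := congrArg (fun x : ringClassField K ι f => (x : ℂ)) h3
  simp only [SubmonoidClass.coe_pow, map_intCast] at h4
  rw [h4]
  simp

end Voight2007

end Literature.NumberTheory.EllipticCurves

end
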